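import Summits.ValiantsHypothesis.ValiantsHypothesis.Theorems.DivisionGapPerDivisionHardStubSparseRigid

/-!
# Crux `DivisionGap.PerDivisionHard` (stmt-ValiantsHypothesis-5065), line `pair-descent-jss-endpoint` —
stub `stub_sparseFamilyRigid` (product-of-sparse-factors rung, wave 3): K2 for a FAMILY of sparse
torus-homogeneous factors, one placement for all of them

`stub_sparseFamilyRigid`: for all `c d` and all large `n`, every finite family `(q j)_{j ∈ J}` of
nonzero torus-homogeneous polynomials in `ℝ≥0[x_ij]` of TOTAL support
`Σ_{j ∈ J} |supp (q j)| ≤ 2^{(log₂ n + c)^c}` admits ONE placement `eR eC` of the block arsenal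
`G(b,k) ⊕ M₀` with `b ≥ (log₂ n + d)^d` and ONE weight `w` cutting out the placed face of the
Birkhoff polytope such that EVERY factor `q j` has a single `G`-part `u j` in its top-`w` fibre.

This is `stub_sparseRigid` (`Theorems/DivisionGapPerDivisionHardStubSparseRigid.lean`) verbatim,
with the same parameters `L = log₂ n`, `q = (L + c + d + 1)^{c+d+1}`, `b = k = q`, `N = q + q³`
corner rows, `t₀ = 4q + 2`, `n ≥ 16 q³`, and two changes:
1. the bad family of row sets is `{T(m₁, m₂) : j ∈ J, m₁, m₂ ∈ supp (q j)}` — pairs of monomials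
   WITHIN a factor — of size `≤ Σ_j |supp (q j)|² ≤ (Σ_j |supp (q j)|)² ≤ 2^{2(L+c)^c} ≤ 2^{t₀}`,
   exactly the bound the single-factor count used (`exists_goodSubset`, `count_lt`, `growth`);
2. the generic weight `genericWeight G B` uses a COMMON radix `B = 1 + Σ_j deg (q j)` exceeding
   the degree of every factor (`eq_offG_of_mem_support_topComponent_radix`, the radix-generalised
   `eq_offG_of_mem_support_topComponent`: two monomials of the same degree in the top fibre of a
   factor agree off `G`).
The placement and `w` are chosen once; the single-fibre conclusion is derived factor by factor
(girth substitute `placedFlow_card_rows`, `placedFlow_row_notPadding`): two monomials of the top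
fibre of `q j` differ by a circulation supported on the placed `G(b,k)` occupying `≥ 4k + 2`
corner rows, i.e. they form an excluded bad pair.  `J = ∅` is allowed (only the placement and
`CutsOut` are used then).

Why it matters: with `stub_torusFamily` it gives `perDivisionHard_sparseProduct` — `PerDivisionHard`
for every cofactor that is a PRODUCT of factors of quasi-polynomially bounded total support (cycle
products `U_ℓ = ∏_{|C| ≤ ℓ} (x^{C⁺} + x^{C⁻})`, the universal exchange cofactor `h_L` with
`n^{O(log n)}` binomial factors, products of relabelled small permanents), none of which is sparse
as a polynomial and none of which any degree-based rung reaches. [folklore]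
-/

noncomputable section

-- `Summit.ValiantsHypothesis.ValiantsHypothesis.…` is the tree's mandated single-conjunct layout
-- (Sub = Summit), so the duplicated namespace component is intended.
set_option linter.dupNamespace false

namespace Summit.ValiantsHypothesis.ValiantsHypothesis.Theorems.DivisionGapPerDivisionHard

open MvPolynomial Literature.Computability.AlgebraicComplexity
open Summit.ValiantsHypothesis.ValiantsHypothesis.Theorems.ZeroOneTransfer.Negative
open scoped NNReal

variable {n : ℕ}

/-! ### The top fibre of the generic weight, arbitrary radix -/

/-- **The top fibre of the generic weight agrees off `G`, for ANY radix `B > deg h`**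
(radix-generalised `eq_offG_of_mem_support_topComponent`): two monomials of the same degree of
`topComponent (genericWeight G B) h` coincide at every cell `e ∉ G` (the weight of a monomial `m`
of `h` is `W · deg m - Σ_{e ∉ G} B^{rank e} m e`, `weight_add_offDigitSum`, and base-`B` digit
vectors are determined by their value, `eq_offG_of_offDigitSum_eq`). [folklore] -/
theorem eq_offG_of_mem_support_topComponent_radix (G : Finset (Fin n × Fin n))
    {h : MvPolynomial (Fin n × Fin n) ℝ≥0} {B : ℕ} (hB : h.totalDegree < B)
    {m₁ m₂ : (Fin n × Fin n) →₀ ℕ}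
    (hm₁ : m₁ ∈ (topComponent (genericWeight G B) h).support)
    (hm₂ : m₂ ∈ (topComponent (genericWeight G B) h).support)
    (hdeg : m₁.degree = m₂.degree) : ∀ e ∉ G, m₁ e = m₂ e := by
  have hB0 : 0 < B := Nat.zero_lt_of_lt hB
  have hs₁ := support_topComponent_subset _ h hm₁
  have hs₂ := support_topComponent_subset _ h hm₂
  have hw₁ := weight_eq_of_mem_support_topComponent _ h hm₁
  have hw₂ := weight_eq_of_mem_support_topComponent _ h hm₂
  have e₁ := weight_add_offDigitSum G hB0 m₁
  have e₂ := weight_add_offDigitSum G hB0 m₂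
  have hlt : ∀ m ∈ h.support, ∀ e, m e < B := fun m hm e =>
    lt_of_le_of_lt ((Finsupp.le_degree e m).trans (le_totalDegree hm)) hB
  refine eq_offG_of_offDigitSum_eq G (hlt m₁ hs₁) (hlt m₂ hs₂) ?_
  rw [hdeg] at e₁
  omega

/-! ### The stub -/

/-- **`stub_sparseFamilyRigid` (K2 of line `pair-descent-jss-endpoint` for a FAMILY of sparse
factors; product-of-sparse-factors rung, wave 3).**  For all `c d` there is `n₀` such that for
`n ≥ n₀` every finite family `(q j)_{j ∈ J}` of nonzero torus-homogeneous `q j ∈ ℝ≥0[x_ij]` of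
total support `Σ_j |supp (q j)| ≤ 2^{(log₂ n + c)^c}` admits ONE placement `eR eC` of
`G(b,k) ⊕ M₀` with `(log₂ n + d)^d ≤ b` and ONE weight `w` cutting out the placed face such that
every factor `q j`, `j ∈ J`, has a single `G`-part `u` of its top-`w` fibre (in fact a single
fibre monomial).  Placement by counting over the `≤ 2^{2(log₂ n+c)^c}` pairs of monomials within
a factor, generic weight with a common radix, girth substitute `4k + 2` — the proof of
`stub_sparseRigid` run for the whole family at once.  It feeds `perDivisionHard_sparseProduct`
(products of sparse factors: cycle products `U_ℓ`, the universal exchange cofactor `h_L`,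
products of relabelled small permanents). [folklore] -/
theorem stub_sparseFamilyRigid :
    ∀ c d : ℕ, ∃ n₀ : ℕ, ∀ n ≥ n₀, ∀ (ι : Type) (J : Finset ι)
      (q : ι → MvPolynomial (Fin n × Fin n) ℝ≥0),
      (∀ j ∈ J, q j ≠ 0) → (∀ j ∈ J, IsTorusHomogeneous (q j)) →
      (∑ j ∈ J, (q j).support.card) ≤ 2 ^ ((Nat.log 2 n + c) ^ c) →
      ∃ (b k m : ℕ) (eR eC : BlockV b k m ≃ Fin n) (w : Fin n × Fin n → ℕ),
        (Nat.log 2 n + d) ^ d ≤ b ∧ CutsOut w (placedBlock eR eC) ∧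
        ∀ j ∈ J, ∃ u : (Fin n × Fin n) →₀ ℕ, HasSingleGPart (placedBlock eR eC) w (q j) u := by
  intro c d
  obtain ⟨L₀, hL₀⟩ := growth (c + d)
  refine ⟨2 ^ (L₀ + 1), fun n hn ι J q hq htor hcard => ?_⟩
  -- the parameters (those of `stub_sparseRigid`)
  have hn0 : n ≠ 0 := by
    have : 1 ≤ 2 ^ (L₀ + 1) := Nat.one_le_two_pow
    omega
  have hLL₀ : L₀ + 1 ≤ Nat.log 2 n := Nat.le_log_of_pow_le one_lt_two hn
  have h2L : 2 ^ Nat.log 2 n ≤ n := Nat.pow_log_le_self 2 hn0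
  have hq16 := hL₀ (Nat.log 2 n) (by omega)
  set L := Nat.log 2 n with hL
  have hy : 2 ≤ L + (c + d) + 1 := by omega
  have hdq : (L + d) ^ d ≤ (L + (c + d) + 1) ^ (c + d + 1) :=
    (Nat.pow_le_pow_left (by omega) d).trans (Nat.pow_le_pow_right (by omega) (by omega))
  have hcq : (L + c) ^ c ≤ (L + (c + d) + 1) ^ (c + d + 1) :=
    (Nat.pow_le_pow_left (by omega) c).trans (Nat.pow_le_pow_right (by omega) (by omega))
  have hq2 : 2 ≤ (L + (c + d) + 1) ^ (c + d + 1) :=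
    (Nat.le_self_pow (Nat.succ_ne_zero _) 2).trans (Nat.pow_le_pow_left hy _)
  set Q := (L + (c + d) + 1) ^ (c + d + 1) with hQ
  have hQ4 : 4 * Q ≤ Q * (Q * Q) := Nat.mul_comm 4 Q ▸ Nat.mul_le_mul_left Q (Nat.mul_le_mul hq2 hq2)
  have hk : 0 < Q := by omega
  -- bad pairs of monomials WITHIN a factor: those differing in at least `4Q + 2` rows
  let T : ((Fin n × Fin n) →₀ ℕ) × ((Fin n × Fin n) →₀ ℕ) → Finset (Fin n) := fun p =>
    Finset.univ.filter fun r => ∃ col, p.1 (r, col) ≠ p.2 (r, col)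
  set S := ∑ j ∈ J, (q j).support.card with hS
  set P := (J.biUnion fun j => (q j).support ×ˢ (q j).support).filter
    fun p => 4 * Q + 2 ≤ (T p).card with hP
  have hPcard : P.card ≤ 2 ^ (4 * Q + 2) :=
    calc P.card ≤ (J.biUnion fun j => (q j).support ×ˢ (q j).support).card :=
          Finset.card_filter_le _ _
      _ ≤ ∑ j ∈ J, ((q j).support ×ˢ (q j).support).card := Finset.card_biUnion_le
      _ = ∑ j ∈ J, (q j).support.card * (q j).support.card :=
          Finset.sum_congr rfl fun j _ => Finset.card_product _ _
      _ ≤ ∑ j ∈ J, (q j).support.card * S :=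
          Finset.sum_le_sum fun j hj => Nat.mul_le_mul_left _
            (Finset.single_le_sum (f := fun j => (q j).support.card)
              (fun _ _ => Nat.zero_le _) hj)
      _ = S * S := (Finset.sum_mul _ _ _).symm
      _ ≤ 2 ^ ((L + c) ^ c) * 2 ^ ((L + c) ^ c) := Nat.mul_le_mul hcard hcard
      _ = 2 ^ (2 * (L + c) ^ c) := by rw [two_mul, pow_add]
      _ ≤ 2 ^ (4 * Q + 2) := Nat.pow_le_pow_right two_pos (by omega)
  -- a good set of `N = Q + Q³` corner rows and the placement, chosen ONCE for the family
  obtain ⟨R, hRcard, hRgood⟩ := exists_goodSubset P T (Q + Q * (Q * Q)) (4 * Q + 2)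
    (fun p hp => (Finset.mem_filter.mp hp).2)
    (by rw [Fintype.card_fin]; exact count_lt (by omega) (by omega) hPcard (by omega))
  obtain ⟨eR, heR₁, heR₂⟩ :=
    exists_blockEquiv R Q Q (n - (Q + Q * (Q * Q))) hRcard (by rw [hRcard])
  set G := placedBlock eR eR with hG
  -- a COMMON radix exceeding the degree of every factor
  set B := (∑ j ∈ J, (q j).totalDegree) + 1 with hB
  have hdegB : ∀ j ∈ J, (q j).totalDegree < B := fun j hj =>
    Nat.lt_succ_of_le
      (Finset.single_le_sum (f := fun j => (q j).totalDegree) (fun _ _ => Nat.zero_le _) hj)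
  -- the generic weight cuts out `G`
  obtain ⟨g, hg⟩ := exists_blockMatching Q Q (n - (Q + Q * (Q * Q))) hk
  obtain ⟨σ₀, hσ₀⟩ := exists_perm_mem_placedBlock eR eR g hg
  have hcut : CutsOut (genericWeight G B) G := cutsOut_genericWeight G (Nat.succ_pos _) σ₀ hσ₀
  -- factor by factor, the top fibre is a single monomial
  have hfib : ∀ j ∈ J, ∀ m₁ ∈ (topComponent (genericWeight G B) (q j)).support,
      ∀ m₂ ∈ (topComponent (genericWeight G B) (q j)).support, m₁ = m₂ := by
    intro j hj m₁ hm₁ m₂ hm₂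
    have hs₁ := support_topComponent_subset _ (q j) hm₁
    have hs₂ := support_topComponent_subset _ (q j) hm₂
    obtain ⟨r₀, c₀, hrc⟩ := htor j hj
    have hoff := eq_offG_of_mem_support_topComponent_radix G (hdegB j hj) hm₁ hm₂
      (degree_eq_of_rowDegrees_eq ((hrc m₁ hs₁).1.trans (hrc m₂ hs₂).1.symm))
    by_contra hne
    -- the difference `D = m₁ - m₂`: supported on `G`, vanishing margins, nonzero
    obtain ⟨hrow, hcol⟩ := sum_diff_eq_zero ((hrc m₁ hs₁).1.trans (hrc m₂ hs₂).1.symm)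
      ((hrc m₁ hs₁).2.trans (hrc m₂ hs₂).2.symm)
    have hDG : ∀ e, (fun e => (m₁ e : ℤ) - m₂ e) e ≠ 0 → e ∈ G := fun e he => by
      by_contra heG
      exact he (by simp only [hoff e heG, sub_self])
    have hDne : ∃ e, (fun e => (m₁ e : ℤ) - m₂ e) e ≠ 0 := by
      by_contra hall
      push Not at hall
      exact hne (Finsupp.ext fun e => by exact_mod_cast sub_eq_zero.mp (hall e))
    have hrows := placedFlow_card_rows eR eR hk hDG hrow hcol hDne
    have hTD : T (m₁, m₂) =
        Finset.univ.filter fun r => ∃ c', (m₁ (r, c') : ℤ) - m₂ (r, c') ≠ 0 := by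
      simp only [T, ne_eq, sub_eq_zero, Nat.cast_inj]
    -- so `(m₁, m₂)` is a bad pair of factor `j` whose rows lie in `R`: excluded by the choice of `R`
    have hmem : (m₁, m₂) ∈ P :=
      Finset.mem_filter.mpr ⟨Finset.mem_biUnion.mpr ⟨j, hj, Finset.mk_mem_product hs₁ hs₂⟩,
        by rw [hTD]; exact hrows⟩
    refine hRgood _ hmem fun r hr => ?_
    rw [hTD] at hr
    obtain ⟨c', hc'⟩ := (Finset.mem_filter.mp hr).2
    have hpad := placedFlow_row_notPadding eR eR hDG hrow hcol hc'
    obtain ⟨x, rfl⟩ := eR.surjective r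
    rcases x with i | p | u
    · exact heR₁ i
    · exact heR₂ p
    · exact absurd (eR.symm_apply_apply _) (hpad u)
  -- conclusion: for each factor, `u` is the `G`-part of the unique monomial of its top fibre
  refine ⟨Q, Q, n - (Q + Q * (Q * Q)), eR, eR, genericWeight G B, hdq, hcut, fun j hj => ?_⟩
  obtain ⟨m₀, hm₀⟩ := support_nonempty.mpr (topComponent_ne_zero (genericWeight G B) (hq j hj))
  refine ⟨m₀.filter (· ∈ G), fun e he => ?_, fun m' hm' e he => ?_⟩
  · rw [Finsupp.support_filter] at he
    exact (Finset.mem_filter.mp he).2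
  · rw [hfib j hj m' hm' m₀ hm₀, Finsupp.filter_apply_pos _ _ he]

end Summit.ValiantsHypothesis.ValiantsHypothesis.Theorems.DivisionGapPerDivisionHard

end
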